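import Summits.BirchSwinnertonDyer.BirchSwinnertonDyer.Theorems.GenusKolyvaginAtTwoMultiGenusPrimitivityAtTwoAuxiliaryFieldRowOne
import Summits.BirchSwinnertonDyer.BirchSwinnertonDyer.Theorems.GenusKolyvaginAtTwoMultiGenusPrimitivityAtTwoAuxiliaryFieldOddTwist

/-!
# Route `GenusKolyvaginAtTwo`, crux stmt-BirchSwinnertonDyer-24947 `MultiGenusPrimitivityAtTwo` (U): on WALL row 1 the certificate
# follows from Mazur–Rubin Cor. 3.4 (i) and the 2-PRIMITIVITY OF ONE RATIONAL POINT ON ONE RANK-ONE ODD TWIST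

Lead prover seat bsd-line-gk2-p1 (g6); composition of `…AuxiliaryFieldRowOne` (p616774: certificate ⟸ cor34i ∧ AUX-PRIMITIVITY)
with `…AuxiliaryFieldOddTwist` (p617773: AUX-PRIMITIVITY(ℓ) ⟺ 2-primitivity up to odd multiples of the rational genus point `z₀`
on the odd twist `W^{(ℓ*)}`). Net statement (`heegner_exists_multiGenusCertificate_rowOne_of_cor34i_of_oddTwistPrimitive`): on the
route's live reach — `Δ(W) < 0`, `ρ̄_{W,2}` onto, `#Sel₂(W) = 4`, Heegner `K` with odd `d_K ≠ −3`, globally minimal twin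
`Wd ≅ W^{(d_K)}` with `#Sel₂(Wd) = 2`, `M₀ ≥ 1` — the crux's `∃`-certificate clause FOLLOWS from the print fact
`MazurRubin2010.cor34i_singleton_rat` and the displayed hypothesis `hprim`: at every Kolyvagin prime `ℓ ≡ 7 (8)` whose even genus
twist `Wd^{(−ℓ)}` is Sel₂-trivial, every rational point `z₀ ∈ W^{(ℓ*)}(ℚ)` whose transport `Φ(ι z₀)` is an odd multiple of the
reduced genus point `W_ℓ` has NO odd multiple in `2·W^{(ℓ*)}(ℚ)`. No ring class field, derived class or `θ`-rationality is left in
the open input: it is a statement about ONE rational point on ONE rank-one quadratic twist of `W` over `ℚ` (W. Zhang's base case of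
Kolyvagin's conjecture read at `p = 2`; not in print at `2`, cf. the crux memo `Cruxes/GenusPrimitiveSupplyAtTwo/Lines/genus-supply-local.md`
§2a/§3). Also: `heegner_theta_not_mem_range` (`θ_ℓ ∉ ℚ`, from `σ_ℓ θ_ℓ = −θ_ℓ`) and the single-prime discharge
`heegner_auxPrimitive_of_oddTwistPrimitive`. CONDITIONAL on `h34` (print) and `hprim` (open); BSD is not proved by any of this.

References: [GrossLMS1991] §3–§5; [McCallumLMS1991] §5; [MazurRubin2010] Cor. 3.4 (i); [SilvermanAEC2009] X.2 Prop. 2.4,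
X.5 Cor. 5.4; [WZhang2014] Thm. 1.1 (the `p ≥ 5` prototype).
-/

set_option linter.dupNamespace false -- tree convention: `Summit.BirchSwinnertonDyer.BirchSwinnertonDyer.Theorems` (summit = sub-problem)

noncomputable section

open scoped Classical

namespace Summit.BirchSwinnertonDyer.BirchSwinnertonDyer.Theorems.GenusKoly

open Finset NumberField WeierstrassCurve Literature.NumberTheory.EllipticCurves
  Literature.NumberTheory.EllipticCurves.ModularForms
  Summit.BirchSwinnertonDyer.Rank1Residual.AdditivePotMult
  Summit.BirchSwinnertonDyer.Rank1Residual.X11b.RingClassConj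

section Heegner

variable {W : WeierstrassCurve ℚ} [NeZero (W.conductorNorm ℤ)] {K : Type} [Field K] [NumberField K]
  {Dt : ModularParametrizationData W (W.conductorNorm ℤ)} {β : ℤ} {ι : K →+* ℂ}

/-- **`θ_ℓ ∉ ℚ`.** The genus radical `θ_ℓ` (`θ_ℓ² = ℓ*`) is moved to `−θ_ℓ` by the generator `σ_ℓ` of `Gal(K[ℓ]/K[1])`
(`heegner_genusRadicals_table`) and is nonzero, so it is not in the image of `ℚ`. [cite: GrossLMS1991, §3 (3.3)] -/
theorem heegner_theta_not_mem_range [W.IsGloballyMinimal] (hK : IsImaginaryQuadratic K)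
    {ℓ : ℕ} (hℓ : ℓ.Prime) (hKoly : ∀ ℓ' ∈ ℓ.primeFactors, Zhang2014.IsKolyvaginPrime (W.conductorNorm ℤ) W K 2 ℓ')
    (d : KolyvaginHeegnerData Dt β ι ℓ) {θ : ℕ → ringClassField K ι ℓ}
    (hθ : ∀ ℓ' ∈ ℓ.primeFactors, θ ℓ' ^ 2 = algebraMap ℚ (ringClassField K ι ℓ) ((-1 : ℚ) ^ (ℓ' / 2) * ℓ')) :
    θ ℓ ∉ Set.range (algebraMap ℚ (ringClassField K ι ℓ)) := by
  have hℓmem : ℓ ∈ ℓ.primeFactors := by rw [Nat.Prime.primeFactors hℓ]; exact Finset.mem_singleton_self ℓ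
  obtain ⟨hθ0, hσ, -⟩ := heegner_genusRadicals_table hK (Irreducible.squarefree hℓ) hKoly d hθ ℓ hℓmem
  rintro ⟨q, hq⟩
  have h : d.σ ℓ (θ ℓ) = θ ℓ := by rw [← hq]; exact (d.σ ℓ).commutes q
  rw [hσ, ← hq, ← map_neg] at h
  have hq0 : q = 0 := by
    have := (algebraMap ℚ (ringClassField K ι ℓ)).injective h
    linarith
  exact hθ0 (by rw [← hq, hq0, map_zero])

/-- **AUX-PRIMITIVITY at one Kolyvagin prime from ODD-TWIST PRIMITIVITY** (the discharge). `ℓ ≡ 3 (4)` a Kolyvagin prime at `2`,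
`Wd = C • W^{(d_K)}` whose even genus twist `Wd^{(−ℓ)}` has all elliptic models Sel₂-trivial, `W_ℓ` a reduced genus point. IF every
rational point `z₀ ∈ W^{(ℓ*)}(ℚ)` with `Φ(ι z₀)` an odd multiple of `W_ℓ` has no odd multiple in `2·W^{(ℓ*)}(ℚ)` (`hprim`), THEN no
odd multiple of `W_ℓ` is twice a `ℚ(θ_ℓ)`-rational point. Assembles `heegner_auxPrimitive_iff_oddTwistPoint` (p617773) with
`θ_ℓ ∉ ℚ`, `√d_K ∈ K ∖ ℚ`, and the finiteness of `W^{(ℓ*·d_K)}(ℚ)` read off `#Sel₂(Wd^{(−ℓ)}) = 1`.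
[cite: GrossLMS1991, §3 (3.3)–(3.5), §5] [cite: SilvermanAEC2009, X.2 Prop. 2.4, X.5 Cor. 5.4] -/
theorem heegner_auxPrimitive_of_oddTwistPrimitive [W.IsElliptic] [W.IsGloballyMinimal]
    (hK : IsImaginaryQuadratic K) (hodd : Odd (NumberField.discr K))
    (hH : SatisfiesHeegnerHypothesis (W.conductorNorm ℤ) K) (hsurj : W.HasSurjectiveModNGaloisRep ((2 : ℤ) ^ 1))
    {ℓ : ℕ} (hℓ : ℓ.Prime) (h4ℓ : 4 ∣ ℓ + 1)
    (hKoly : ∀ ℓ' ∈ ℓ.primeFactors, Zhang2014.IsKolyvaginPrime (W.conductorNorm ℤ) W K 2 ℓ')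
    (d : KolyvaginHeegnerData Dt β ι ℓ) {θ : ℕ → ringClassField K ι ℓ}
    (hθ : ∀ ℓ' ∈ ℓ.primeFactors, θ ℓ' ^ 2 = algebraMap ℚ (ringClassField K ι ℓ) ((-1 : ℚ) ^ (ℓ' / 2) * ℓ'))
    (G : Finset (ringClassField K ι ℓ ≃ₐ[ℚ] ringClassField K ι ℓ)) (hG : ∀ g, g ∈ G ↔ g ∈ ringClassGal ι ℓ)
    {Wd : WeierstrassCurve ℚ} [Wd.IsElliptic] {C : VariableChange ℚ}
    (hWd : C • W.quadraticTwist (NumberField.discr K : ℚ) = Wd)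
    (hSel1 : ∀ (W₂ : WeierstrassCurve ℚ) [W₂.IsElliptic],
      (∃ C₂ : VariableChange ℚ, C₂ • Wd.quadraticTwist (-(ℓ : ℚ)) = W₂) → Nat.card (W₂.selmerGroup 2) = 1)
    {Wn : (W.baseChange (ringClassField K ι ℓ)).toAffine.Point}
    (hWn : ((2 : ℤ) ^ ℓ.primeFactors.card) • Wn =
      ∑ g ∈ G, (∏ ℓ' ∈ ℓ.primeFactors, (if g (θ ℓ') = θ ℓ' then (1 : ℤ) else -1)) •
        pointGalHom W (ringClassField K ι ℓ) g d.y)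
    (hprim : ∀ (hθQ : θ ℓ ∉ Set.range (algebraMap ℚ (ringClassField K ι ℓ)))
        (hθℓ : θ ℓ ^ 2 = algebraMap ℚ (ringClassField K ι ℓ) ((-1 : ℚ) ^ (ℓ / 2) * ℓ))
        (m₀ : ℕ) (z₀ : (W.quadraticTwist ((-1 : ℚ) ^ (ℓ / 2) * ℓ)).toAffine.Point), Odd m₀ →
        twistPointEquivOver W hθQ hθℓ
          (QuadraticDescent.incl (ringClassField K ι ℓ : Type) (W.quadraticTwist ((-1 : ℚ) ^ (ℓ / 2) * ℓ)) z₀) =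
            (m₀ : ℤ) • Wn →
        ∀ m : ℕ, Odd m → ¬ ∃ z : (W.quadraticTwist ((-1 : ℚ) ^ (ℓ / 2) * ℓ)).toAffine.Point,
          (2 : ℤ) • z = (m : ℤ) • z₀) :
    ∀ m : ℕ, Odd m → ¬ ∃ Q : (W.baseChange (ringClassField K ι ℓ)).toAffine.Point,
      (∀ g : ringClassField K ι ℓ ≃ₐ[ℚ] ringClassField K ι ℓ, g (θ ℓ) = θ ℓ →
        pointGalHom W (ringClassField K ι ℓ) g Q = Q) ∧ (2 : ℤ) • Q = (m : ℤ) • Wn := by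
  have hℓmem : ℓ ∈ ℓ.primeFactors := by rw [Nat.Prime.primeFactors hℓ]; exact Finset.mem_singleton_self ℓ
  have hθℓ := hθ ℓ hℓmem
  have hθQ := heegner_theta_not_mem_range hK hℓ hKoly d hθ
  obtain ⟨s₀, hs₀, hs₀2⟩ := heegner_exists_sqrt_discr hK
  -- the even genus twist `Wd^{(−ℓ)}` is an elliptic model of `W^{(ℓ*·d_K)}` with `#Sel₂ = 1`, so `W^{(ℓ*·d_K)}(ℚ)` is finite
  have hℓ0 : (-(ℓ : ℚ)) ≠ 0 := neg_ne_zero.mpr (by exact_mod_cast hℓ.ne_zero)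
  haveI : (Wd.quadraticTwist (-(ℓ : ℚ))).IsElliptic := isElliptic_quadraticTwist Wd hℓ0
  have hSelWe : Nat.card ((Wd.quadraticTwist (-(ℓ : ℚ))).selmerGroup 2) = 1 := hSel1 _ ⟨1, one_smul _ _⟩
  obtain ⟨C', hC'⟩ := exists_smul_quadraticTwist_pStar_mul_eq_twin_quadraticTwist (W := W) h4ℓ hWd
  have htw : Finite (W.quadraticTwist (((-1 : ℚ) ^ (ℓ / 2) * ℓ) * (NumberField.discr K : ℚ))).toAffine.Point :=
    finite_point_of_card_selmerGroup_two_eq_one _ _ ⟨C', hC'⟩ hSelWe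
  obtain ⟨⟨m₀, z₀, hm₀, hz₀⟩, hiff⟩ :=
    heegner_auxPrimitive_iff_oddTwistPoint hK hodd hH hsurj hℓ hKoly d hθ hθQ hθℓ G hG hs₀ hs₀2 htw hWn
  exact (hiff m₀ z₀ hm₀ hz₀).mpr (hprim hθQ hθℓ m₀ z₀ hm₀ hz₀)

/-- **WALL ROW 1: the crux's certificate from Cor. 3.4 (i) and ODD-TWIST PRIMITIVITY.** `W` globally minimal with `Δ < 0`,
`ρ̄_{W,2}` onto, `#Sel₂(W) = 4`; a Heegner field `K` with odd `d_K ≠ −3`; a globally minimal twin `Wd = C • W^{(d_K)}` with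
`#Sel₂(Wd) = 2`; a conductor-1 datum `d₁` with `2 ∣ P(1)` (`M₀ ≥ 1`). IF (`hprim`) at every Kolyvagin prime `ℓ ≡ 7 (8)` at `2`
whose even genus twist `Wd^{(−ℓ)}` has all elliptic models Sel₂-trivial, for all data / radicals / enumerations / reduced genus
points `W_ℓ`, every rational point `z₀` of the ODD twist `W^{(ℓ*)}` whose transport `Φ(ι z₀)` is an odd multiple of `W_ℓ` has no
odd multiple in `2·W^{(ℓ*)}(ℚ)` — THEN the certificate clause of `MultiGenusPrimitivityAtTwo` / `stub_positiveDepth` holds.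
CONDITIONAL on the print fact `cor34i_singleton_rat` (`h34`) and on `hprim` (the open kernel, now a statement about one rational
point on one rank-one quadratic twist over `ℚ`); the Kolyvagin prime, datum, radicals, `G`, `W_ℓ` (and `z₀`, by p617773) are PRODUCED.
[cite: MazurRubin2010, Cor. 3.4 (i), Prop. 3.3] [cite: GrossLMS1991, §3 (3.1)–(3.5), §4 (4.1), Lemma 4.3, §5]
[cite: McCallumLMS1991, §5] [cite: WZhang2014, Thm. 1.1 (the p ≥ 5 prototype)] -/
theorem heegner_exists_multiGenusCertificate_rowOne_of_cor34i_of_oddTwistPrimitive [W.IsElliptic] [W.IsGloballyMinimal]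
    (h34 : MazurRubin2010.cor34i_singleton_rat)
    (hK : IsImaginaryQuadratic K) (hodd : Odd (NumberField.discr K)) (h3 : NumberField.discr K ≠ -3)
    (hH : SatisfiesHeegnerHypothesis (W.conductorNorm ℤ) K) (hsurj : W.HasSurjectiveModNGaloisRep ((2 : ℤ) ^ 1))
    (hΔ : W.Δ < 0) (h4 : Nat.card (W.selmerGroup 2) = 4)
    {Wd : WeierstrassCurve ℚ} [Wd.IsElliptic] [Wd.IsGloballyMinimal] {C : VariableChange ℚ}
    (hWd : C • W.quadraticTwist (NumberField.discr K : ℚ) = Wd) (h2 : Nat.card (Wd.selmerGroup 2) = 2)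
    (d₁ : KolyvaginHeegnerData Dt β ι 1)
    (hM : ∃ Q₁ : (W.baseChange (ringClassField K ι 1)).toAffine.Point, (2 : ℤ) • Q₁ = d₁.derivedPoint)
    (hprim : ∀ ℓ : ℕ, ℓ.Prime → ℓ % 8 = 7 → Zhang2014.IsKolyvaginPrime (W.conductorNorm ℤ) W K 2 ℓ →
      (∀ (W₂ : WeierstrassCurve ℚ) [W₂.IsElliptic],
        (∃ C₂ : VariableChange ℚ, C₂ • Wd.quadraticTwist (-(ℓ : ℚ)) = W₂) → Nat.card (W₂.selmerGroup 2) = 1) →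
      ∀ (d : KolyvaginHeegnerData Dt β ι ℓ) (θ : ℕ → ringClassField K ι ℓ),
        (∀ ℓ' ∈ ℓ.primeFactors, θ ℓ' ^ 2 = algebraMap ℚ (ringClassField K ι ℓ) ((-1 : ℚ) ^ (ℓ' / 2) * ℓ')) →
      ∀ (hθQ : θ ℓ ∉ Set.range (algebraMap ℚ (ringClassField K ι ℓ)))
        (hθℓ : θ ℓ ^ 2 = algebraMap ℚ (ringClassField K ι ℓ) ((-1 : ℚ) ^ (ℓ / 2) * ℓ)),
      ∀ (G : Finset (ringClassField K ι ℓ ≃ₐ[ℚ] ringClassField K ι ℓ)), (∀ g, g ∈ G ↔ g ∈ ringClassGal ι ℓ) →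
      ∀ (Wn : (W.baseChange (ringClassField K ι ℓ)).toAffine.Point),
        ((2 : ℤ) ^ ℓ.primeFactors.card) • Wn =
          ∑ g ∈ G, (∏ ℓ' ∈ ℓ.primeFactors, (if g (θ ℓ') = θ ℓ' then (1 : ℤ) else -1)) •
            pointGalHom W (ringClassField K ι ℓ) g d.y →
      ∀ (m₀ : ℕ) (z₀ : (W.quadraticTwist ((-1 : ℚ) ^ (ℓ / 2) * ℓ)).toAffine.Point), Odd m₀ →
        twistPointEquivOver W hθQ hθℓ
          (QuadraticDescent.incl (ringClassField K ι ℓ : Type) (W.quadraticTwist ((-1 : ℚ) ^ (ℓ / 2) * ℓ)) z₀) =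
            (m₀ : ℤ) • Wn →
      ∀ m : ℕ, Odd m → ¬ ∃ z : (W.quadraticTwist ((-1 : ℚ) ^ (ℓ / 2) * ℓ)).toAffine.Point,
        (2 : ℤ) • z = (m : ℤ) • z₀) :
    ∃ (n : ℕ) (d : KolyvaginHeegnerData Dt β ι n) (θ : ℕ → ringClassField K ι n)
      (T : Finset (ringClassField K ι n ≃ₐ[ℚ] ringClassField K ι n)),
      Squarefree n ∧ (∀ ℓ ∈ n.primeFactors, Zhang2014.IsKolyvaginPrime (W.conductorNorm ℤ) W K 2 ℓ) ∧
      (∀ ℓ ∈ n.primeFactors, θ ℓ ^ 2 = algebraMap ℚ (ringClassField K ι n) ((-1 : ℚ) ^ (ℓ / 2) * ℓ)) ∧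
      (∀ g, g ∈ T ↔ g ∈ ringClassGal ι n ∧ ∀ ℓ ∈ n.primeFactors, g (θ ℓ) = θ ℓ) ∧
      ¬ ∃ Q : (W.baseChange (ringClassField K ι n)).toAffine.Point, (2 : ℤ) • Q =
        ∑ g ∈ T, pointGalHom W (ringClassField K ι n) g d.y := by
  refine heegner_exists_multiGenusCertificate_rowOne_of_cor34i_of_auxPrimitive h34 hK hodd h3 hH hsurj hΔ h4 hWd h2 d₁ hM
    fun ℓ hℓ hℓ8 hKolyZ hSel1 d θ hθ G hG Wn hWn ↦ ?_
  have hKoly : ∀ ℓ' ∈ ℓ.primeFactors, Zhang2014.IsKolyvaginPrime (W.conductorNorm ℤ) W K 2 ℓ' := by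
    intro ℓ' hℓ'
    rw [Nat.Prime.primeFactors hℓ, Finset.mem_singleton] at hℓ'
    rw [hℓ']
    exact hKolyZ
  exact heegner_auxPrimitive_of_oddTwistPrimitive hK hodd hH hsurj hℓ (by omega) hKoly d hθ G hG hWd hSel1 hWn
    (fun hθQ hθℓ ↦ hprim ℓ hℓ hℓ8 hKolyZ hSel1 d θ hθ hθQ hθℓ G hG Wn hWn)

end Heegner

end Summit.BirchSwinnertonDyer.BirchSwinnertonDyer.Theorems.GenusKoly

end
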